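import Mathlib
import HarnessLib
import Literature.Combinatorics.Additive.Pollard
import Literature.Combinatorics.Additive.Kneser
import Literature.Combinatorics.Additive.GrynkiewiczPollardRep
import Literature.Combinatorics.Additive.GrynkiewiczPollardKneserTools
import Literature.Combinatorics.Additive.GrynkiewiczPollardStepOne
import Literature.Combinatorics.Additive.GrynkiewiczPollardStepTwo
import Literature.Combinatorics.Additive.GrynkiewiczPollardDyson

/-!
# Grynkiewicz's extension of Pollard's theorem — port, part VI: STEP 3 for `t ≥ 3` (Case 3.2)

Topic: `Literature/Combinatorics/Additive`.  Sixth file of the port of [Gry10] Theorem 1.1 / 1.2.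
STEP 3 of [Gry10] §2 shows that the maximal translate `x + B` meets `A` in at least `t` points; this file
treats Case 3.2 (`t ≥ 3`): assuming every translate of `B` not contained in `A` meets `A` in at most
`t − 1` points, the goal follows — via `N_t ≥ t|A| + 1`, the coset trap, the bounds (qubal)/(T-bone) on
`T = {z : z + B ⊆ A}`, and the additive-energy Lemma 2.1 (here in a square-root-free discrete form:
`N_t + U = |A||B| + tn`, `U² ≤ n Σ r²`, `Σ r² ≤ |T||B|² + (t−1)(|A||B| − |T||B|)`, followed by an
elementary polynomial contradiction `case32_arith`).

## References
* D. J. Grynkiewicz, *On extending Pollard's theorem for t-representable sums*, Israel J. Math. 177 (2010)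
  413–439 (arXiv:0803.2601), §2 Lemma 2.1 and Case 3.2 [cite: Grynkiewicz2010, Lemma 2.1].
-/

namespace Literature.Combinatorics.Additive

namespace Grynkiewicz

open Finset Pollard
open scoped Pointwise

variable {G : Type*} [AddCommGroup G] [DecidableEq G]

section StepThree

variable {t c : ℕ} {A B : Finset G}

/-! ### `N_t ≥ t|A| + 1` -/

/-- If `|B| ≥ t + 1` and `|stab(A)| ≤ t`, then `N_t(A,B) ≥ t|A| + 1`: for a `(t+1)`-subset `B₀`,
`N_t(A,B₀) = (t+1)|A| − #{w : w − B₀ ⊆ A}` and the subtracted set has fewer than `|A|` elements, else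
`B₀ − B₀ ⊆ stab(A)`. [cite: Grynkiewicz2010, §2 Case 3.2] -/
theorem mul_card_lt_NS (hB : t + 1 ≤ B.card) (hstab : A.addStab.card ≤ t) (hA : A.Nonempty) :
    t * A.card + 1 ≤ NS t A B := by
  obtain ⟨B0, hB0B, hB0c⟩ := exists_subset_card_eq hB
  have hfull := NS_add_card_full_eq A hB0c
  have hB0ne : B0.Nonempty := card_pos.1 (by omega)
  obtain ⟨b0, hb0⟩ := hB0ne
  set F := (A + B0).filter (fun w => ∀ b ∈ B0, w - b ∈ A) with hF
  have hinj : Set.InjOn (fun w => w - b0) ↑F := fun w _ w' _ (e : w - b0 = w' - b0) => sub_left_injective e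
  have himg : F.image (fun w => w - b0) ⊆ A := fun x hx => by
    obtain ⟨w, hw, rfl⟩ := mem_image.1 hx
    exact (mem_filter.1 hw).2 b0 hb0
  have hFle : F.card ≤ A.card := by rw [← card_image_of_injOn hinj]; exact card_le_card himg
  have hFlt : F.card < A.card := by
    refine lt_of_le_of_ne hFle fun heq => ?_
    have himgeq : F.image (fun w => w - b0) = A :=
      eq_of_subset_of_card_le himg (by rw [card_image_of_injOn hinj, heq])
    have hsub : ∀ b ∈ B0, b - b0 ∈ A.addStab := by
      intro b hb
      have h1 : b0 - b ∈ A.addStab := by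
        refine mem_addStab_of_forall_add_mem hA fun a ha => ?_
        have ha' : a ∈ F.image (fun w => w - b0) := by rw [himgeq]; exact ha
        obtain ⟨w, hw, hwa⟩ := mem_image.1 ha'
        have hwb := (mem_filter.1 hw).2 b hb
        have e : b0 - b + a = w - b := by rw [← hwa]; abel
        rw [e]; exact hwb
      have := neg_mem_addStab h1
      rwa [neg_sub] at this
    have := card_le_card_addStab_of_sub_mem hsub
    omega
  have e : (t + 1) * A.card = t * A.card + A.card := by ring
  calc t * A.card + 1 ≤ NS t A B0 := by omega
    _ ≤ NS t A B := NS_mono_right t A hB0B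

/-! ### The energy bookkeeping ([Gry10] Lemma 2.1, discrete form) -/

/-- `N_t + U = |A||B| + t n` where `P = {w : r(w) > t}`, `n = |P|`, `U = Σ_{w ∈ P} r(w)`.
[cite: Grynkiewicz2010, Lemma 2.1] -/
theorem NS_add_sum_popular (t : ℕ) (A B : Finset G) :
    NS t A B + ∑ w ∈ (A + B).filter (fun w => t < rep A B w), rep A B w =
      A.card * B.card + t * ((A + B).filter (fun w => t < rep A B w)).card := by
  have h3 := sum_filter_add_sum_filter_not (A + B) (fun w => t < rep A B w) (fun w => rep A B w)
  rw [sum_rep_of_subset (Subset.refl _)] at h3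
  have h0 := sum_filter_add_sum_filter_not (A + B) (fun w => t < rep A B w) (fun w => min t (rep A B w))
  have h1 : ∑ w ∈ (A + B).filter (fun w => t < rep A B w), min t (rep A B w) =
      t * ((A + B).filter (fun w => t < rep A B w)).card := by
    rw [sum_const_nat (fun w hw => min_eq_left (le_of_lt (mem_filter.1 hw).2)), mul_comm]
  have h2 : ∑ w ∈ (A + B).filter (fun w => ¬ t < rep A B w), min t (rep A B w) =
      ∑ w ∈ (A + B).filter (fun w => ¬ t < rep A B w), rep A B w :=
    sum_congr rfl fun w hw => min_eq_right (not_lt.1 (mem_filter.1 hw).2)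
  unfold NS
  omega

/-- Cauchy–Schwarz on the popular set: `U² ≤ n · Σ_{w ∈ A+B} r(w)²`. [cite: Grynkiewicz2010, Lemma 2.1] -/
theorem sum_popular_sq_le (t : ℕ) (A B : Finset G) :
    (∑ w ∈ (A + B).filter (fun w => t < rep A B w), rep A B w) *
        (∑ w ∈ (A + B).filter (fun w => t < rep A B w), rep A B w) ≤
      ((A + B).filter (fun w => t < rep A B w)).card * ∑ w ∈ A + B, rep A B w ^ 2 := by
  have h1 := sq_sum_le_card_mul_sum_sq (s := (A + B).filter (fun w => t < rep A B w)) (f := fun w => rep A B w)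
  rw [sq] at h1
  refine h1.trans (Nat.mul_le_mul_left _ ?_)
  exact sum_le_sum_of_subset_of_nonneg (filter_subset _ _) fun _ _ _ => Nat.zero_le _

/-- `U ≤ |A||B|`. [cite: Grynkiewicz2010, Lemma 2.1] -/
theorem sum_popular_le (t : ℕ) (A B : Finset G) :
    ∑ w ∈ (A + B).filter (fun w => t < rep A B w), rep A B w ≤ A.card * B.card := by
  rw [← sum_rep_of_subset (Subset.refl (A + B))]
  exact sum_le_sum_of_subset_of_nonneg (filter_subset _ _) fun _ _ _ => Nat.zero_le _

/-- The energy bound from the `A − B` side: if every translate `z + B` not contained in `A` meets `A` in at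
most `t − 1` points, then with `T = {z : z + B ⊆ A}`:
`Σ_{w} r(w)² + (t−1)|T||B| ≤ |T||B|² + (t−1)|A||B|`. [cite: Grynkiewicz2010, Lemma 2.1] -/
theorem sum_rep_sq_le (ht : 1 ≤ t)
    (hm : ∀ z : G, (A ∩ (z +ᵥ B)).card + 1 ≤ t ∨ z +ᵥ B ⊆ A) :
    ∑ w ∈ A + B, rep A B w ^ 2 + (t - 1) * (((A - B).filter (fun z => z +ᵥ B ⊆ A)).card * B.card) ≤
      ((A - B).filter (fun z => z +ᵥ B ⊆ A)).card * B.card * B.card + (t - 1) * (A.card * B.card) := by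
  rw [sum_rep_sq_eq_sum_card_inter_vadd_sq]
  set T := (A - B).filter (fun z => z +ᵥ B ⊆ A) with hT
  have hsplit2 := sum_filter_add_sum_filter_not (A - B) (fun z => z +ᵥ B ⊆ A)
    (fun z => (A ∩ (z +ᵥ B)).card ^ 2)
  have hsplit1 := sum_filter_add_sum_filter_not (A - B) (fun z => z +ᵥ B ⊆ A)
    (fun z => (A ∩ (z +ᵥ B)).card)
  rw [sum_card_inter_vadd] at hsplit1
  rw [← hT] at hsplit1 hsplit2
  -- on `T`: `f = |B|`
  have hT1 : ∑ z ∈ T, (A ∩ (z +ᵥ B)).card = T.card * B.card := by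
    rw [sum_const_nat (fun z hz => card_inter_vadd_of_subset (mem_filter.1 hz).2), mul_comm]
  have hT2 : ∑ z ∈ T, (A ∩ (z +ᵥ B)).card ^ 2 = T.card * B.card * B.card := by
    rw [sum_const_nat (m := B.card * B.card) (fun z hz => by rw [card_inter_vadd_of_subset (mem_filter.1 hz).2, sq])]
    ring
  -- off `T`: `f ≤ t - 1`, so `f² ≤ (t-1) f`
  have hoff : ∑ z ∈ (A - B).filter (fun z => ¬ z +ᵥ B ⊆ A), (A ∩ (z +ᵥ B)).card ^ 2 ≤
      (t - 1) * ∑ z ∈ (A - B).filter (fun z => ¬ z +ᵥ B ⊆ A), (A ∩ (z +ᵥ B)).card := by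
    rw [mul_sum]
    refine sum_le_sum fun z hz => ?_
    have hle : (A ∩ (z +ᵥ B)).card ≤ t - 1 := by
      rcases hm z with h | h
      · omega
      · exact absurd h (mem_filter.1 hz).2
    rw [sq]; exact Nat.mul_le_mul_right _ hle
  have hsum1 : ∑ z ∈ (A - B).filter (fun z => ¬ z +ᵥ B ⊆ A), (A ∩ (z +ᵥ B)).card =
      A.card * B.card - T.card * B.card := by omega
  rw [hsum1] at hoff
  have hle2 : T.card * B.card ≤ A.card * B.card := by rw [← hT1]; omega
  rw [← hsplit2, hT2]
  have := Nat.sub_add_cancel hle2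
  zify [hle2] at hoff ⊢
  nlinarith [hoff]

/-- `(p + q)² + 2q ≤ 4pq` is impossible for `p ≥ 1` (AM–GM). [cite: Grynkiewicz2010, Lemma 2.1] -/
theorem amgm_aux (p q : ℕ) (hp : 1 ≤ p) (h : (p + q) * (p + q) + 2 * q ≤ 4 * q * p) : False := by
  nlinarith [sq_nonneg ((p : ℤ) - q)]

/-- The elementary endgame of Case 3.2, in shifted variables `t = t′ + 1`, `b = k + 2t + 1`, `a = b + m`:
the energy facts `N_t + U = ab + tn`, `U² ≤ nW`, `U ≤ ab`, `W + t′|T|b ≤ |T|b² + t′ab`, the bound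
`|T| + b + 1 ≤ a + t` and the failure of the Pollard bound `N_t + 2t² ≤ t(a+b)` are contradictory.
[cite: Grynkiewicz2010, §2 Case 3.2] -/
theorem case32_arith (t' k m a b X M D s T n U W N : ℕ)
    (hb : b = k + 2 * (t' + 1) + 1) (ha : a = b + m) (hX : X = a * b)
    (hM : M = 2 * k + 2 * t' + 4 + m) (hD : D = (k + t' + 2 + m) * (k + t' + 2) + (t' + 1) * (t' + 1))
    (hs : s = k + t' + 3)
    (hT : T + b + 1 ≤ a + (t' + 1))
    (hNS : N + 2 * (t' + 1) * (t' + 1) ≤ (t' + 1) * (a + b))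
    (hE1 : N + U = X + (t' + 1) * n)
    (hE2 : U * U ≤ n * W) (hUle : U ≤ X)
    (hW : W + t' * (T * b) ≤ T * b * b + t' * (a * b)) :
    False := by
  have hMD : (t' + 1) * M + D = X := by rw [hM, hD, hX, ha, hb]; ring
  have hMab : (t' + 1) * (a + b) = (t' + 1) * M + 2 * (t' + 1) * (t' + 1) := by rw [hM, ha, hb]; ring
  have hMa : M = a + k + 1 := by rw [hM, ha, hb]; ring
  have hTle : T ≤ m + t' := by rw [ha, hb] at hT; omega
  have hU : D + (t' + 1) * n ≤ U := by rw [hMab] at hNS; linarith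
  by_cases hWc : W ≤ 2 * (t' + 1) * X
  · have h2D' : 2 * D = X + (k + 1 + m) * (k + 1) := by rw [hX, hD, ha, hb]; ring
    have hkm : 1 ≤ (k + 1 + m) * (k + 1) := Nat.one_le_iff_ne_zero.2 (by positivity)
    have h2D : X + 1 ≤ 2 * D := by rw [h2D']; omega
    have h3 : (D + (t' + 1) * n) * (D + (t' + 1) * n) ≤ U * U := Nat.mul_le_mul hU hU
    have hnW : n * W ≤ n * (2 * (t' + 1) * X) := Nat.mul_le_mul_left n hWc
    have hh : 2 * (t' + 1) * n * (X + 1) ≤ 2 * (t' + 1) * n * (2 * D) := Nat.mul_le_mul_left _ h2D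
    have hD1 : 1 ≤ D := by rw [hD]; nlinarith
    have key : (D + (t' + 1) * n) * (D + (t' + 1) * n) + 2 * ((t' + 1) * n) ≤ 4 * ((t' + 1) * n) * D := by
      linarith [h3, hE2, hnW, hh]
    exact amgm_aux D ((t' + 1) * n) hD1 key
  · rw [not_le] at hWc
    have h2 : (t' + 1) * (X + U) ≤ W := by
      have := Nat.mul_le_mul_left (t' + 1) hUle; linarith
    obtain ⟨V, hV⟩ : ∃ V, X = U + V := ⟨X - U, by omega⟩
    have s1 : (t' + 1) * (U * U) ≤ (t' + 1) * (n * W) := Nat.mul_le_mul_left _ hE2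
    have s2 : (D + (t' + 1) * n) * W ≤ U * W := Nat.mul_le_mul_right W hU
    have s4 : V * ((t' + 1) * (X + U)) ≤ V * W := Nat.mul_le_mul_left V h2
    have h5 : (t' + 1) * (X * X) + D * W ≤ X * W := by
      rw [hV] at s4 ⊢; linarith [s1, s2, s4]
    have h6 : (t' + 1) * (X * X) ≤ (t' + 1) * (M * W) := by
      rw [← hMD] at h5 ⊢; linarith [h5]
    have hMW : X * X ≤ M * W := Nat.le_of_mul_le_mul_left h6 (by omega)
    have hW2 : W + b * (s * s) ≤ a * b * b := by
      obtain ⟨e, he⟩ : ∃ e, m + t' = T + e := ⟨m + t' - T, by omega⟩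
      have h4 : (m + t') * (b * b) + t' * (a * b) + b * (s * s) = a * b * b + t' * ((m + t') * b) := by
        rw [hs, ha, hb]; ring
      rw [he] at h4
      have hbt : t' * (e * b) ≤ b * (e * b) := Nat.mul_le_mul_right (e * b) (by rw [hb]; omega)
      linarith [hW, h4, hbt]
    have hss' : s * s = b * (k + 1) + 2 * b + t' * t' := by rw [hs, hb]; ring
    have hb1 : 1 ≤ b := by rw [hb]; omega
    have hss : b * (k + 1) + 1 ≤ s * s := by rw [hss']; omega
    have h7 : M * (W + b * (s * s)) ≤ M * (a * b * b) := Nat.mul_le_mul_left M hW2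
    have h9 := Nat.mul_le_mul_left (M * b) hss
    have hpos : 1 ≤ M * b := Nat.one_le_iff_ne_zero.2 (by rw [hM, hb]; positivity)
    rw [hX] at hMW
    have hnn : 0 ≤ (k + 1) * (k + 1) * (b * b) := Nat.zero_le _
    clear hW hW2 h5 h6 s1 s2 s4 h2 hWc hU hE1 hE2 hNS hT hMab hMD hUle hTle hV hD hM hs hss hss' hX hb1
    subst hMa
    linarith [hMW, h7, h9, hpos, hnn]

/-! ### STEP 3, Case 3.2 -/

/-- **[Gry10] §2 STEP 3, Case 3.2 (`t ≥ 3`).**  Let `3 ≤ t`, `t² ≤ c`, `2t² ≤ c + 1`, `|A| ≥ |B| ≥ t + 1`,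
and assume the induction hypothesis below `(A,B)`.  If every translate `z + B` not contained in `A` meets
`A` in at most `t − 1` points (i.e. the maximal Dyson translate is small), then `Goal t c A B`.
[cite: Grynkiewicz2010, §2 Case 3.2] -/
theorem step_three_ge3 (ht : 3 ≤ t) (hc : t * t ≤ c) (hc2 : 2 * t * t ≤ c + 1) (ih : IH t c A B)
    (hBA : B.card ≤ A.card) (hB : t + 1 ≤ B.card)
    (hm : ∀ z : G, (A ∩ (z +ᵥ B)).card + 1 ≤ t ∨ z +ᵥ B ⊆ A) : Goal t c A B := by
  have hA : t + 1 ≤ A.card := hB.trans hBA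
  have hAne : A.Nonempty := card_pos.1 (by omega)
  have hBne : B.Nonempty := card_pos.1 (by omega)
  by_cases hstab : t ≤ A.addStab.card
  · exact goal_of_card_addStab_ge (by omega) hc ih hA hB hstab
  rw [not_le] at hstab
  have hN1 := mul_card_lt_NS hB (by omega) hAne (t := t)
  by_cases hP : t * (A.card + B.card) ≤ NS t A B + c
  · exact Or.inl hP
  rw [not_le] at hP
  have hb2 : 2 * t + 1 ≤ B.card := by
    by_contra h
    rw [not_le] at h
    have h1 : t * B.card ≤ t * (2 * t) := Nat.mul_le_mul_left t (by omega)
    have h2 : t * (A.card + B.card) = t * A.card + t * B.card := by ring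
    have h3 : t * (2 * t) = 2 * t * t := by ring
    omega
  -- the translates of `B` inside `A`
  set T := (A - B).filter (fun z => z +ᵥ B ⊆ A) with hTdef
  have hTB : T + B ⊆ A := translates_add_subset
  have key : Goal t c A B ∨ T.card + B.card + 1 ≤ A.card + t := by
    rcases T.eq_empty_or_nonempty with hT0 | hTne
    · right; rw [hT0, card_empty]; omega
    set H := (T + B).addStab with hH
    have hTBne : (T + B).Nonempty := hTne.add hBne
    have hper : T + B + H = T + B := add_addStab _
    -- (a) is `B` inside one `H`-coset?
    by_cases hBc : ∃ b₀ ∈ B, B ⊆ b₀ +ᵥ H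
    · obtain ⟨b₀, -, hBsub⟩ := hBc
      by_cases hAc : ∃ a₀ ∈ A, A ⊆ a₀ +ᵥ H
      · exfalso
        obtain ⟨a₀, -, hAsub⟩ := hAc
        obtain ⟨w, hw⟩ := hTBne
        have hwA : w ∈ A := hTB hw
        have hcos : w +ᵥ H ⊆ T + B := coset_subset_of_periodic hper hw
        have hAcos : A ⊆ w +ᵥ H := by rw [coset_eq_of_mem (hAsub hwA)]; exact hAsub
        have hTBA : T + B = A := Subset.antisymm hTB (hAcos.trans hcos)
        have hHA : H = A.addStab := by rw [hH, hTBA]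
        have h1 : B.card ≤ H.card := (card_le_card hBsub).trans (card_vadd_finset _ _).le
        rw [hHA] at h1
        omega
      · push Not at hAc
        exact Or.inl (goal_of_subset_coset (by omega) hc ih hA hB hBsub hAc)
    push Not at hBc
    -- (b) every `H`-coset meets `B` in at most `t - 1` points
    have hqubal : ∀ b ∈ B, (B ∩ (b +ᵥ H)).card + 1 ≤ t := by
      intro b hb
      by_contra hcon
      rw [not_le] at hcon
      obtain ⟨b', hb', hb'c⟩ := not_subset.1 (hBc b hb)
      apply hb'c
      rw [mem_coset_iff]
      refine addStab_subset_addStab_add hBne (mem_addStab_of_forall_add_mem hTne fun z hz => ?_)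
      rw [mem_translates_iff hBne]
      rcases hm (b' - b + z) with hsmall | hbig
      · exfalso
        have hsub : (b' - b + z) +ᵥ (B ∩ (b +ᵥ H)) ⊆ A ∩ ((b' - b + z) +ᵥ B) := by
          intro x hx
          obtain ⟨b'', hb'', rfl⟩ := mem_vadd_finset.1 hx
          rw [mem_inter, mem_coset_iff] at hb''
          refine mem_inter.2 ⟨?_, mem_vadd_finset.2 ⟨b'', hb''.1, rfl⟩⟩
          have e : (b' - b + z) +ᵥ b'' = (z + b') + (b'' - b) := by rw [vadd_eq_add]; abel
          rw [e]
          apply hTB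
          rw [← hper]
          exact add_mem_add (add_mem_add hz hb') hb''.2
        have := card_le_card hsub
        rw [card_vadd_finset] at this
        omega
      · exact hbig
    -- (c) the bound on `|T|`
    right
    by_contra hcon
    rw [not_le] at hcon
    have hlt : (T + B).card < T.card + B.card := lt_of_le_of_lt (card_le_card hTB) (by omega)
    have htight := kneser_eq_of_card_add_lt hTne hBne hlt
    rw [← hH] at htight
    obtain ⟨b, hb⟩ := hBne
    have h1 := card_addStab_le_card_inter_coset_add_holes hTBne hb (A := B) (S := T + B)
    rw [← hH] at h1
    have h2 : T.card ≤ (T + H).card := card_le_card_add_right hTBne.addStab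
    have h3 := hqubal b hb
    have h4 := card_le_card hTB
    have h5 : B.card ≤ (B + H).card := card_le_card_add_right hTBne.addStab
    omega
  rcases key with hG | hTbone
  · exact hG
  -- (d) the energy contradiction
  exfalso
  have hE1 := NS_add_sum_popular t A B
  have hE2 := sum_popular_sq_le t A B
  have hUle := sum_popular_le t A B
  have hW := sum_rep_sq_le (by omega) hm
  rw [← hTdef] at hW
  obtain ⟨t', rfl⟩ : ∃ t', t = t' + 1 := ⟨t - 1, by omega⟩
  simp only [Nat.add_sub_cancel] at hW
  obtain ⟨k, hk⟩ : ∃ k, B.card = k + 2 * (t' + 1) + 1 := ⟨B.card - (2 * (t' + 1) + 1), by omega⟩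
  obtain ⟨m, hm'⟩ : ∃ m, A.card = B.card + m := ⟨A.card - B.card, by omega⟩
  exact case32_arith t' k m A.card B.card (A.card * B.card) _ _ _ T.card _ _ _ (NS (t' + 1) A B)
    hk hm' rfl rfl rfl rfl hTbone (by omega) hE1 hE2 hUle hW

end StepThree

end Grynkiewicz

end Literature.Combinatorics.Additive
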